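import Mathlib
import Summits.NavierStokesRegularity.NavierStokesRegularity.Theorems.FilamentSkeletonRssSkeletonJ1LSymmetricStreamline
import Summits.NavierStokesRegularity.NavierStokesRegularity.Theorems.FilamentSkeletonRssSkeletonJ1RLiaDefectDerivSplit

/-!
# `SkeletonJ1L` (stmt-NavierStokesRegularity-23296): the IRREDUCIBLE one-curve form — the slip IS the true slip (definitional), its differentiability derived

Last link of this hand's chain (p837172 → p837299 → p837719/p837806 → p837917/p837996).  In `skeletonJ1L_of_halfTurnStreamline_coordFloor` the family still
supplies a slip function `w₀` with the identity `w₀ = ⟪trueField(X)(X₀ ·), X₀′⟫` and its differentiability.  Here `w₀` is SUBSTITUTED by the true slip and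
`Differentiable` is DERIVED from `Theorems.SkeletonJ1RFrame.trueField_differentiable` (matched-core Biot–Savart toolkit at rigid unit cores; `C¹` strands with
`‖X′‖ ≤ 1` and linear growth — the growth from the near-straight escape with `cg = 7/8`).
★ `skeletonJ1L_of_symmetricTrueStreamline` — `Theses.FilamentSkeletonRss.SkeletonJ1L` BY NAME from `Theses.FilamentSkeletonRss.Clause13NearStraightL` and a family
(box constants; `∀ 0 < Rb ≤ Rb₁ ≤ ½`; all large `Γ`) of ONE `C²` unit-speed curve `X₀`, presented with its half-turn image as `X = (X₀, R_π X₀)`, such that: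
curvature `≤ K/√Γ`, tangent oscillation `≤ Rb`, first-coordinate floor `(X₀ τ)₀ ≥ ρ√Γ/2`, waist `‖X₀(cc)‖ ≤ Rw√Γ`, tilt `|⟪X₀′(cc), e₃⟫| ≤ 1 − θ₀`, the TRUE
⟪trueField Γ (fun _ : Fin 2 => 125 * Real.pi / 108) (875/432 : ℝ) X (X 0 τ), deriv (X 0) τ⟫_ℝ `s(τ) = ⟪trueField(X)(X₀ τ), X₀′ τ⟫` (`γ ≡ 125π/108`, `α = 875/432`) vanishes only at `cc` with `3/2 + δ ≤ s′(cc) ≤ Λ` and `|s′| ≤ Λ`, and `X₀` is an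
EXACT STREAMLINE on the ball: `trueField(X)(X₀ τ) = s(τ)·X₀′(τ)` for `‖X₀ τ‖ ≤ Rb√(Γ log Γ)`.
HONEST FRAMING: bookkeeping about a HYPOTHETICAL filament skeleton on the NEGATIVE side of a MODEL route; the existence of such a streamline and the clause-13
child remain OPEN; nothing bears on Navier–Stokes regularity or blow-up.  `--supports stmt-NavierStokesRegularity-23296`. [folklore]
-/

set_option linter.dupNamespace false

noncomputable section

namespace Summit.NavierStokesRegularity.NavierStokesRegularity.Theorems.SkeletonJ1LSymmetricTrueStreamline

open Filter MeasureTheory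
open scoped InnerProductSpace BigOperators
open Literature.Analysis.FluidPDE
open Summit.NavierStokesRegularity.NavierStokesRegularity.Theorems.SkeletonJ1RFrame (trueField trueField_differentiable)
open Summit.NavierStokesRegularity.NavierStokesRegularity.Theorems.SkeletonJ1LSymmetricPair
  (norm_eq_of_halfTurn contDiff_halfTurn deriv_halfTurn linear_growth_of_escape)
open Summit.NavierStokesRegularity.NavierStokesRegularity.Theorems.SkeletonJ1LSymmetricStreamline (skeletonJ1L_of_halfTurnStreamline_coordFloor)

/-- **The true slip of a near-straight `C²` strand in the `R_π` class is differentiable** (`trueField` differentiable in the evaluation point, composed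
with `X₀ ∈ C²` and paired with `X₀′ ∈ C¹`). [folklore] -/
theorem differentiable_trueSlip {X : Fin 2 → ℝ → EuclideanSpace ℝ (Fin 3)} {Γ Rb Rw cc : ℝ} {γ : Fin 2 → ℝ} {α : ℝ}
    (hsym : ∀ σ, X 1 σ 0 = -X 0 σ 0 ∧ X 1 σ 1 = -X 0 σ 1 ∧ X 1 σ 2 = X 0 σ 2) (hC : ContDiff ℝ 2 (X 0))
    (hunit : ∀ τ, ‖deriv (X 0) τ‖ = 1) (hosc : ∀ τ σ, ‖deriv (X 0) τ - deriv (X 0) σ‖ ≤ Rb) (hRb : Rb ≤ 1 / 2)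
    (hwaist : ‖X 0 cc‖ ≤ Rw * √Γ) :
    Differentiable ℝ (fun τ => ⟪trueField Γ γ α X (X 0 τ), deriv (X 0) τ⟫_ℝ) := by
  have hC1 : ContDiff ℝ 2 (X 1) := contDiff_halfTurn hsym hC
  have hCk : ∀ k, ContDiff ℝ 2 (X k) := Fin.forall_fin_two.mpr ⟨hC, hC1⟩
  have hd : ∀ k, Differentiable ℝ (X k) := fun k => (hCk k).differentiable (by norm_num)
  have hder := fun τ => deriv_halfTurn hsym hd τ
  have hn : ∀ τ, ‖X 1 τ‖ = ‖X 0 τ‖ := fun τ => norm_eq_of_halfTurn (hsym τ)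
  have hunit1 : ∀ τ, ‖deriv (X 1) τ‖ = 1 := fun τ => by rw [norm_eq_of_halfTurn (hder τ)]; exact hunit τ
  have hesc : ∀ τ, 7 / 8 * |τ - cc| ≤ Rw * √Γ + ‖X 0 τ‖ :=
    fun τ => NearStraightGeometry.escape_of_nearStraight (hd 0) hunit hosc hRb hwaist τ
  have hgrow : ∀ k u, 7 / 8 * |u| - (7 / 8 * |cc| + Rw * √Γ) ≤ ‖X k u‖ := by
    refine Fin.forall_fin_two.mpr ⟨linear_growth_of_escape hesc, fun u => ?_⟩
    rw [hn u]; exact linear_growth_of_escape hesc u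
  have hle : ∀ k u, ‖deriv (X k) u‖ ≤ 1 :=
    Fin.forall_fin_two.mpr ⟨fun u => (hunit u).le, fun u => (hunit1 u).le⟩
  have htf : Differentiable ℝ (trueField Γ γ α X) :=
    trueField_differentiable (by norm_num : (0:ℝ) < 7 / 8) (fun k => (hCk k).of_le (by norm_num)) hle hgrow
  have hdd : Differentiable ℝ (deriv (X 0)) := by
    have := hC.differentiable_iteratedDeriv 1 (by norm_num)
    rwa [iteratedDeriv_one] at this
  exact (htf.comp (hd 0)).inner ℝ hdd

/-- ★ **`SkeletonJ1L` BY NAME from ONE exact streamline with its TRUE slip (irreducible form) and the clause-13 child.** [folklore] -/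
theorem skeletonJ1L_of_symmetricTrueStreamline
    (hfam : ∃ (δ ρ K Λ Rw θ₀ Rb₁ : ℝ), 0 < δ ∧ 0 < ρ ∧ 0 < Rw ∧ 0 < θ₀ ∧ 0 < Rb₁ ∧ Rb₁ ≤ 1 / 2 ∧ 2 * K * ρ ≤ 1 ∧ 1 ≤ Λ ∧
      (θ₀ ≤ |(875/432 : ℝ)| ∧ |(875/432 : ℝ)| ≤ θ₀⁻¹ ∧ θ₀ ≤ |(125 * Real.pi / 108 : ℝ)| ∧ |(125 * Real.pi / 108 : ℝ)| ≤ θ₀⁻¹) ∧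
      ∀ Rb : ℝ, 0 < Rb → Rb ≤ Rb₁ → ∃ Γ₂ : ℝ, ∀ Γ : ℝ, Γ₂ ≤ Γ →
        ∃ (X : Fin 2 → ℝ → EuclideanSpace ℝ (Fin 3)) (cc : ℝ),
          (∀ σ, X 1 σ 0 = -X 0 σ 0 ∧ X 1 σ 1 = -X 0 σ 1 ∧ X 1 σ 2 = X 0 σ 2) ∧
          ContDiff ℝ 2 (X 0) ∧ (∀ τ, ‖deriv (X 0) τ‖ = 1) ∧ (∀ τ, ‖iteratedDeriv 2 (X 0) τ‖*√Γ≤K) ∧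
          (∀ τ σ, ‖deriv (X 0) τ - deriv (X 0) σ‖ ≤ Rb) ∧
          (∀ τ, ρ * √Γ / 2 ≤ X 0 τ 0) ∧ ‖X 0 cc‖≤Rw*√Γ ∧ |⟪deriv (X 0) cc, EuclideanSpace.single 2 1⟫_ℝ|≤1-θ₀ ∧
          ((fun τ => ⟪trueField Γ (fun _ : Fin 2 => 125 * Real.pi / 108) (875/432 : ℝ) X (X 0 τ), deriv (X 0) τ⟫_ℝ) cc = 0 ∧ (∀ τ, (fun τ => ⟪trueField Γ (fun _ : Fin 2 => 125 * Real.pi / 108) (875/432 : ℝ) X (X 0 τ), deriv (X 0) τ⟫_ℝ) τ = 0 → τ = cc) ∧ 3/2+δ ≤ deriv (fun τ => ⟪trueField Γ (fun _ : Fin 2 => 125 * Real.pi / 108) (875/432 : ℝ) X (X 0 τ), deriv (X 0) τ⟫_ℝ) cc ∧ deriv (fun τ => ⟪trueField Γ (fun _ : Fin 2 => 125 * Real.pi / 108) (875/432 : ℝ) X (X 0 τ), deriv (X 0) τ⟫_ℝ) cc ≤ Λ) ∧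
          (∀ τ, |deriv (fun τ => ⟪trueField Γ (fun _ : Fin 2 => 125 * Real.pi / 108) (875/432 : ℝ) X (X 0 τ), deriv (X 0) τ⟫_ℝ) τ| ≤ Λ) ∧
          (∀ τ, ‖X 0 τ‖≤Rb*√(Γ*Real.log Γ) →
            trueField Γ (fun _ : Fin 2 => 125 * Real.pi / 108) (875/432 : ℝ) X (X 0 τ) = ⟪trueField Γ (fun _ : Fin 2 => 125 * Real.pi / 108) (875/432 : ℝ) X (X 0 τ), deriv (X 0) τ⟫_ℝ•deriv (X 0) τ))
    (h3 : Summit.NavierStokesRegularity.NavierStokesRegularity.Theses.FilamentSkeletonRss.Clause13NearStraightL) :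
    Summit.NavierStokesRegularity.NavierStokesRegularity.Theses.FilamentSkeletonRss.SkeletonJ1L := by
  obtain ⟨δ, ρ, K, Λ, Rw, θ₀, Rb₁, hδ, hρ, hRw, hθ₀, hRb₁, hRbh, hKρ, hΛ, hbox, hfam⟩ := hfam
  refine skeletonJ1L_of_halfTurnStreamline_coordFloor ⟨δ, ρ, K, Λ, Rw, θ₀, Rb₁, hδ, hρ, hRw, hθ₀, hRb₁, hRbh, hKρ, hΛ, hbox, ?_⟩ h3
  intro Rb hRb hRb1
  obtain ⟨Γ₂, hΓ⟩ := hfam Rb hRb hRb1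
  refine ⟨Γ₂, fun Γ hΓ2 => ?_⟩
  obtain ⟨X, cc, hsym, hC, hunit, hcurv, hosc, hfloor, hwaist, htilt, hzero, hw', htan⟩ := hΓ Γ hΓ2
  exact ⟨X, (fun τ => ⟪trueField Γ (fun _ : Fin 2 => 125 * Real.pi / 108) (875/432 : ℝ) X (X 0 τ), deriv (X 0) τ⟫_ℝ), cc, hsym, hC, hunit, hcurv, hosc, hfloor, hwaist, htilt, fun _ => rfl,
    differentiable_trueSlip hsym hC hunit hosc (hRb1.trans hRbh) hwaist, hzero, hw', htan⟩

end Summit.NavierStokesRegularity.NavierStokesRegularity.Theorems.SkeletonJ1LSymmetricTrueStreamline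

end
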